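import Literature.Probability.Percolation.TwoSetConditionalAssociation
import HarnessLib

/-!
# van den Berg–Häggström–Kahn (2006), Theorem 1.1 — two separation sets `X, Y`
# (measure form; single source `s` and, by Remark 1, a source SET `S`) — PROVED

Topic `Literature/Probability/Percolation`.  Companion of `ConditionalPositiveAssociation.lean`
(Thm. 1.3 as a named fact, discharged in `ConditionalPositiveAssociationProofs.lean`, whose internal
engine `BHK2006.core` IS Theorem 1.1 — but only as a finite weighted sum for percolation restricted to
a vertex set `U`, the form its induction needs) and of `TwoSetConditionalAssociation.lean` (the
set forms of Thms. 1.3–1.5).  That file's docstring lists Theorem 1.1 under "Not restated"; this file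
states and PROVES it at measure level, for `μ = prodBernoulli w` (bond percolation with arbitrary edge
probabilities `w e = p_e` on a finite vertex type `V`, `BondConfig V = Set (Sym2 V)`), in the event
form printed by BHK and in the functional form of `BHK2006.core`, for a single source vertex `s` and
for a source SET `S` (Remark 1 after Thm. 1.2).  No definition and no named fact is introduced.

## Source, as printed (CWI report PNA-R0406 = arXiv:math/0408176 = RSA 29 (2006) 417–435)

§1, p. 3: "Let `s` be a fixed vertex. By the open cluster, `C_s`, of `s` we mean the set of all edges
which are in open paths starting at `s`. As in [BK01] we define, for `X ⊆ V`, the event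
`R_X := {s ↮ X} = {s ↮ x ∀ x ∈ X}`. … We also say that `A` is increasing and determined by the open
cluster of `s` if `ω ∈ A` and `C_s(ω′) ⊇ C_s(ω)` imply `ω′ ∈ A`. … A simple example of such an event
is `{s ↔ a}`.  The following statement is a natural generalization of Theorem 1.2 of [BK01].
**Theorem 1.1.** Let `A` and `B` be increasing events determined by the open cluster of `s`. Then
for all `X, Y ⊆ V ∖ {s}`,  `Pr(A R_X) Pr(B R_Y) ≤ Pr(A B R_{X∩Y}) Pr(R_{X∪Y})`.  (3)"
(proof for finite `G` by induction on `|V|`, pp. 3–5; Thm. 1.2 is `Y = X`).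
P. 5, Remark 1 after Thm. 1.2: "… Similarly, we could replace `s` in all results of this section, and
`t` in Theorems 1.4 and 1.5, by sets of vertices."  (Reduction printed there: "simply identify the
vertices of `X`, retaining all edges connecting them to `V ∖ X`".)
P. 16, Remark (ii) after Thm. 3.2 (Thm. 3.1 = Thm. 1.1 for directed percolation, which "contains
Theorem 1.1"): "Taking `A = B = Ω` in Theorem 3.1 gives `Pr(R_X) Pr(R_Y) ≤ Pr(R_{X∪Y}) Pr(R_{X∩Y})`."

## What is proved here (all sorry-free; trust base = the kernel)

* `BHK2006_twoSeparationSets_fun` — Thm. 1.1 in the functional form of `BHK2006.core`, at measure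
  level: for `F, G ≥ 0` increasing functions of `C_s = openEdgeCluster ω s` and any `X, Y ⊆ V`,
  `(∫_{R_X} F(C_s) dμ)(∫_{R_Y} G(C_s) dμ) ≤ (∫_{R_{X∩Y}} F(C_s) G(C_s) dμ) · μ(R_{X∪Y})`,
  `R_W = {ω | ∀ x ∈ W, ¬ (openGraph ω).Reachable s x}`.  (For `X ≠ Y` nonnegativity of `F, G` cannot
  be dropped; `s ∈ X` or `s ∈ Y` makes the left side vanish, so BHK's `X, Y ⊆ V ∖ {s}` is not needed.)
* `BHK2006_twoSeparationSets` — **Theorem 1.1 as printed** (events): for increasing events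
  `A = {P(C_s)}`, `B = {Q(C_s)}` determined by the open cluster of `s`,
  `μ(R_X ∩ A) μ(R_Y ∩ B) ≤ μ(R_{X∩Y} ∩ (A ∩ B)) μ(R_{X∪Y})`.
* `BHK2006_twoSeparationSets.separationEvents` — the case `A = B = Ω` (Remark (ii) p. 16):
  `μ(R_X) μ(R_Y) ≤ μ(R_{X∩Y}) μ(R_{X∪Y})` (sharper than Harris, which gives only `≤ μ(R_{X∪Y})`).
* `BHK2006_setTwoSeparationSets_fun`, `BHK2006_setTwoSeparationSets` — the same two statements with
  the source `s` replaced by a SET `S` (Remark 1): `C_S = ⋃_{s ∈ S} C_s`,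
  `R_W = {S ↮ W} = {ω | ∀ s ∈ S, ∀ x ∈ W, s ↮ x}`.  Proved by BHK's identification of the vertices
  of `S`, realised on the fixed configuration space by the hub construction of
  `TwoSetConditionalAssociation.lean` (one hub `inr true` joined to `S` by weight-`1` edges, the
  second hub idle: `sides S ∅`), which transports `BHK2006_twoSeparationSets_fun` on `V ⊕ Bool`.

* `VandenbergKahn2001_connectionSeparation`, `VandenbergKahn2001_setConnectionSeparation` — van den
  Berg–Kahn 2001, Thm. 1.2 as printed (`P(Q_A R_X) P(Q_B R_Y) ≤ P(Q_{A∪B} R_{X∩Y}) P(R_{X∪Y})`,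
  `Q_W = {s ↔ w ∀ w ∈ W}`) and its set-source form (their Remark 3), as corollaries.

These are the "two-separation-set" pieces (`{s ↔ all of W} ∩ {s ↮ Y}` against `{s ↮ X}`) that the
relay arguments of the percolation-near-one routes under
`Summits/CriticalPhenomena/PercolationContinuityZ3` (crux `NoHeavyLowerTail`, stmt-CriticalPhenomena-4575,
one-cut line, rung `|A| = 5`) asked for; with `Y = X` they reduce to the tree's Thm. 1.3 / 1.2.

## References

* J. van den Berg, O. Häggström, J. Kahn, *Some conditional correlation inequalities for
  percolation and related processes*, Random Structures Algorithms 29 (2006) 417–435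
  (arXiv:math/0408176; CWI report PNA-R0406): Thm. 1.1 (p. 3, eq. (3)), Remark 1 after Thm. 1.2
  (p. 5), Remark (ii) after Thm. 3.2 (p. 16). [VandenbergHaggstromKahn2005]
* J. van den Berg, J. Kahn, *A correlation inequality for connection events in percolation*,
  Ann. Probab. 29 (2001) 123–126: Thm. 1.2 (p. 123, eq. (1)), Remarks 2–3 (p. 124) (the special case
  `A = Q_W`, `B = Q_{W'}` of BHK's Thm. 1.1; BHK's [BK01]). [VandenbergKahn2001]
-/

noncomputable section

open MeasureTheory Set
open Literature.Probability.LatticeModels (prodBernoulli)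

namespace Literature.Probability.Percolation

variable {V : Type*}

open BHK2006 DecisionTree in
/-- **van den Berg–Häggström–Kahn (2006), Theorem 1.1, functional form.**  Bond percolation with
arbitrary edge probabilities `w` on a finite vertex type, `μ = prodBernoulli w`; `s` a vertex,
`X, Y ⊆ V`, `R_W = {ω | ∀ x ∈ W, s ↮ x}`, and `F, G ≥ 0` increasing functions of the open edge
cluster `C_s = openEdgeCluster ω s`.  Then
`(∫_{R_X} F(C_s) dμ) · (∫_{R_Y} G(C_s) dμ) ≤ (∫_{R_{X∩Y}} F(C_s) G(C_s) dμ) · μ(R_{X∪Y})`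
— for indicators `F = 1_A`, `G = 1_B` this is the printed
"`Pr(A R_X) Pr(B R_Y) ≤ Pr(A B R_{X∩Y}) Pr(R_{X∪Y})`".  Obtained from the tree's finite-sum Theorem 1.1
`BHK2006.core` (proved there by BHK's induction on the vertex set) with `U = univ`, after identifying
`prodBernoulli w` on the finite type `Set (Sym2 V)` with the finite weighted sum.
[cite: VandenbergHaggstromKahn2005, Thm. 1.1 (p. 3, eq. (3)), proof pp. 3–5] -/
theorem BHK2006_twoSeparationSets_fun [Fintype V] (w : Sym2 V → unitInterval) (s : V) (X Y : Set V)
    (F G : Set (Sym2 V) → ℝ) (hF : Monotone F) (hG : Monotone G)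
    (hF0 : ∀ a, 0 ≤ F a) (hG0 : ∀ a, 0 ≤ G a) :
    (∫ ω in {ω : BondConfig V | ∀ x ∈ X, ¬ (openGraph ω).Reachable s x},
        F (openEdgeCluster ω s) ∂(prodBernoulli w)) *
      (∫ ω in {ω : BondConfig V | ∀ x ∈ Y, ¬ (openGraph ω).Reachable s x},
        G (openEdgeCluster ω s) ∂(prodBernoulli w)) ≤
    (∫ ω in {ω : BondConfig V | ∀ x ∈ X ∩ Y, ¬ (openGraph ω).Reachable s x},
        F (openEdgeCluster ω s) * G (openEdgeCluster ω s) ∂(prodBernoulli w)) *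
      (prodBernoulli w).real {ω : BondConfig V | ∀ x ∈ X ∪ Y, ¬ (openGraph ω).Reachable s x} := by
  classical
  set w' : Sym2 V → ℝ := fun e => (w e : ℝ) with hw'
  have hw0 : ∀ e, 0 ≤ w' e := fun e => (w e).2.1
  have hw1 : ∀ e, w' e ≤ 1 := fun e => (w e).2.2
  -- the integrals as finite sums
  have hint : ∀ (D : Set (BondConfig V)) (h : Set (Sym2 V) → ℝ),
      ∫ ω in D, h ω ∂(prodBernoulli w) = ∑ ω, weight w' ω * (h ω * ind D ω) := by
    intro D h
    have hDm : MeasurableSet D := MeasurableSet.of_discrete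
    rw [← integral_indicator hDm, integral_prodBernoulli_eq_sum]
    refine Finset.sum_congr rfl fun ω _ => ?_
    by_cases hω : ω ∈ D
    · rw [Set.indicator_of_mem hω, ind_of_mem hω, mul_one]
    · rw [Set.indicator_of_notMem hω, ind_of_not_mem hω]; ring
  have hreal : ∀ D : Set (BondConfig V),
      (prodBernoulli w).real D = ∑ ω, weight w' ω * ind D ω := by
    intro D
    have hDm : MeasurableSet D := MeasurableSet.of_discrete
    rw [← integral_indicator_one hDm, integral_prodBernoulli_eq_sum]
    refine Finset.sum_congr rfl fun ω _ => ?_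
    by_cases hω : ω ∈ D
    · rw [Set.indicator_of_mem hω, ind_of_mem hω, Pi.one_apply]
    · rw [Set.indicator_of_notMem hω, ind_of_not_mem hω, mul_zero]
  have hm : ∑ ω, weight w' ω = 1 := by
    have h1 := integral_prodBernoulli_eq_sum w fun _ => (1 : ℝ)
    simp only [integral_const, probReal_univ, smul_eq_mul, mul_one] at h1
    exact h1.symm
  -- `U = univ`: the restricted quantities are the original ones
  have hE : ∀ ω : Set (Sym2 V), ω ∩ edgesIn (Finset.univ : Finset V) = ω := fun ω => by
    ext e
    simp only [Set.mem_inter_iff, edgesIn, Set.mem_setOf_eq, Finset.mem_univ, imp_true_iff,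
      and_true]
  have hC : ∀ ω, rC Finset.univ s ω = openEdgeCluster ω s := fun ω => by
    simp only [rC, hE]
  have hDD : ∀ W : Set V,
      rD Finset.univ s W = {ω : BondConfig V | ∀ x ∈ W, ¬ (openGraph ω).Reachable s x} := fun W => by
    ext ω
    simp only [rD, hE, Set.mem_setOf_eq]
  have hXU : X ⊆ ↑(Finset.univ : Finset V) := by simp
  have hYU : Y ⊆ ↑(Finset.univ : Finset V) := by simp
  -- Theorem 1.1 (finite-sum form)
  have key := core w' hw0 hw1 hm Finset.univ s (Finset.mem_univ s) X Y hXU hYU F G hF hG hF0 hG0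
  simp only [hC, hDD] at key
  rw [hint, hint, hint {ω : BondConfig V | ∀ x ∈ X ∩ Y, ¬ (openGraph ω).Reachable s x}
    (fun ω => F (openEdgeCluster ω s) * G (openEdgeCluster ω s)), hreal]
  exact key

open TripodExchange in
/-- **van den Berg–Häggström–Kahn (2006), Theorem 1.1** (as printed, for events).  "Let `A` and `B`
be increasing events determined by the open cluster of `s`. Then for all `X, Y ⊆ V ∖ {s}`,
`Pr(A R_X) Pr(B R_Y) ≤ Pr(A B R_{X∩Y}) Pr(R_{X∪Y})`" (`R_W = {s ↮ W}`; bond percolation with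
arbitrary edge probabilities; finite graphs).  In the tree's vocabulary: `μ = prodBernoulli w` on a
finite vertex type, `A = {ω | P (C_s ω)}`, `B = {ω | Q (C_s ω)}` with `P, Q` predicates of edge sets
increasing for `⊆` (`C_s = openEdgeCluster ω s`), `R_W = {ω | ∀ x ∈ W, ¬ (openGraph ω).Reachable s x}`:
`μ(R_X ∩ A) · μ(R_Y ∩ B) ≤ μ(R_{X∩Y} ∩ (A ∩ B)) · μ(R_{X∪Y})`.  (`X, Y ⊆ V ∖ {s}` is not needed:
`s ∈ X ∪ Y` makes the left side vanish.)  From `BHK2006_twoSeparationSets_fun` with indicator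
functions. [cite: VandenbergHaggstromKahn2005, Thm. 1.1 (p. 3, eq. (3))] -/
theorem BHK2006_twoSeparationSets [Fintype V] (w : Sym2 V → unitInterval) (s : V) (X Y : Set V)
    (P Q : Set (Sym2 V) → Prop)
    (hP : ∀ ⦃C C' : Set (Sym2 V)⦄, C ⊆ C' → P C → P C')
    (hQ : ∀ ⦃C C' : Set (Sym2 V)⦄, C ⊆ C' → Q C → Q C') :
    (prodBernoulli w).real ({ω : BondConfig V | ∀ x ∈ X, ¬ (openGraph ω).Reachable s x} ∩
        {ω | P (openEdgeCluster ω s)}) *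
      (prodBernoulli w).real ({ω : BondConfig V | ∀ x ∈ Y, ¬ (openGraph ω).Reachable s x} ∩
        {ω | Q (openEdgeCluster ω s)}) ≤
    (prodBernoulli w).real ({ω : BondConfig V | ∀ x ∈ X ∩ Y, ¬ (openGraph ω).Reachable s x} ∩
        ({ω | P (openEdgeCluster ω s)} ∩ {ω | Q (openEdgeCluster ω s)})) *
      (prodBernoulli w).real {ω : BondConfig V | ∀ x ∈ X ∪ Y, ¬ (openGraph ω).Reachable s x} := by
  classical
  have key := BHK2006_twoSeparationSets_fun w s X Y
    (fun C => if P C then (1 : ℝ) else 0) (fun C => if Q C then (1 : ℝ) else 0)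
    (predIndicator_monotone hP) (predIndicator_monotone hQ)
    (fun a => by split_ifs <;> norm_num) (fun a => by split_ifs <;> norm_num)
  simp only [predIndicator_openEdgeCluster, setIntegral_indicator_one_eq,
    setIntegral_indicator_mul_indicator_eq] at key
  exact key

/-- **The separation events are log-supermodular in the target set** (BHK, Remark (ii) after
Thm. 3.2, p. 16: "Taking `A = B = Ω` in Theorem 3.1 [= Thm. 1.1, directed or not] gives
`Pr(R_X) Pr(R_Y) ≤ Pr(R_{X∪Y}) Pr(R_{X∩Y})`"): `μ{s ↮ X} · μ{s ↮ Y} ≤ μ{s ↮ X∩Y} · μ{s ↮ X∪Y}`.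
(Harris' inequality alone gives only `μ(R_X) μ(R_Y) ≤ μ(R_X ∩ R_Y) = μ(R_{X∪Y})`.)
[cite: VandenbergHaggstromKahn2005, Remark (ii) after Thm. 3.2 (p. 16), Thm. 1.1 (p. 3)] -/
theorem BHK2006_twoSeparationSets.separationEvents [Fintype V] (w : Sym2 V → unitInterval) (s : V)
    (X Y : Set V) :
    (prodBernoulli w).real {ω : BondConfig V | ∀ x ∈ X, ¬ (openGraph ω).Reachable s x} *
      (prodBernoulli w).real {ω : BondConfig V | ∀ x ∈ Y, ¬ (openGraph ω).Reachable s x} ≤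
    (prodBernoulli w).real {ω : BondConfig V | ∀ x ∈ X ∩ Y, ¬ (openGraph ω).Reachable s x} *
      (prodBernoulli w).real {ω : BondConfig V | ∀ x ∈ X ∪ Y, ¬ (openGraph ω).Reachable s x} := by
  have key := BHK2006_twoSeparationSets w s X Y (fun _ => True) (fun _ => True)
    (fun _ _ _ h => h) (fun _ _ _ h => h)
  simpa only [setOf_true, inter_univ] using key

/-! ## The source replaced by a set of vertices (Remark 1 after Thm. 1.2)

BHK: "we could replace `s` in all results of this section … by sets of vertices" — by identifying the
vertices of the set.  On the fixed configuration space this is the hub construction of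
`TwoSetConditionalAssociation.lean`, used here with ONE active hub: `sides S ∅` joins the hub
`inr true` to every vertex of `S` by a weight-`1` edge and leaves the hub `inr false` idle, so the
separation hypothesis of that file's lemmas is vacuous. -/

namespace TwoSeparationSets

open TwoSetConditionalAssociation

/-- With the second block empty, the blocks are (vacuously) not joined. [folklore] -/
theorem hub_sep_empty (S : Set V) (ω : BondConfig V) :
    ∀ s ∈ sides S (∅ : Set V) true, ∀ t ∈ sides S (∅ : Set V) (!true),
      ¬ (openGraph ω).Reachable s t := fun s _ t ht _ => by
  simp only [Bool.not_true, sides_false, mem_empty_iff_false] at ht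

/-- **`{s* ↮ inl″W}` pulls back to `{S ↮ W}`.** [folklore] -/
theorem hubConfig_preimage_forall_not_reachable (S W : Set V) :
    hubConfig (sides S (∅ : Set V)) ⁻¹'
        {ω' : BondConfig (V ⊕ Bool) | ∀ x' ∈ Sum.inl '' W,
          ¬ (openGraph ω').Reachable (Sum.inr true) x'} =
      {ω : BondConfig V | ∀ s ∈ S, ∀ x ∈ W, ¬ (openGraph ω).Reachable s x} := by
  ext ω
  simp only [mem_preimage, mem_setOf_eq, forall_mem_image]
  constructor
  · intro h s hs x hx hsx
    exact h hx (hubConfig_reachable_hub_inl (sides S ∅) ω (b := true) hs hsx)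
  · intro h x hx hreach
    obtain ⟨s, hs, hsx⟩ :=
      exists_reachable_of_hub_reachable (sides S ∅) ω true (hub_sep_empty S ω) hreach
    exact h s hs x hx hsx

/-- **The hub's cluster, read on the old pairs, is `C_S = ⋃_{s ∈ S} C_s`** (no separation hypothesis
is needed when the second hub is idle). [folklore] -/
theorem restrictConfig_openEdgeCluster_hub_empty (S : Set V) (ω : BondConfig V) :
    restrictConfig Sum.inl (openEdgeCluster (hubConfig (sides S (∅ : Set V)) ω) (Sum.inr true)) =
      ⋃ s ∈ S, openEdgeCluster ω s :=
  restrictConfig_openEdgeCluster_hub (sides S ∅) ω true (hub_sep_empty S ω)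

end TwoSeparationSets

open TwoSeparationSets TwoSetConditionalAssociation in
/-- **Theorem 1.1 with the source a SET of vertices, functional form** (BHK Remark 1 after
Thm. 1.2, p. 5: "we could replace `s` in all results of this section … by sets of vertices").  For a
set `S`, `C_S ω = ⋃_{s ∈ S} openEdgeCluster ω s`, `R_W = {S ↮ W} = {ω | ∀ s ∈ S, ∀ x ∈ W, s ↮ x}`, and
`F, G ≥ 0` increasing:
`(∫_{R_X} F(C_S) dμ) · (∫_{R_Y} G(C_S) dμ) ≤ (∫_{R_{X∩Y}} F(C_S) G(C_S) dμ) · μ(R_{X∪Y})`.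
PROVED by BHK's identification of the vertices of `S` (hub construction, one active hub) from
`BHK2006_twoSeparationSets_fun` on `V ⊕ Bool`.
[cite: VandenbergHaggstromKahn2005, Thm. 1.1 (p. 3) with Remark 1 after Thm. 1.2 (p. 5)] -/
theorem BHK2006_setTwoSeparationSets_fun [Fintype V] (w : Sym2 V → unitInterval) (S X Y : Set V)
    (F G : Set (Sym2 V) → ℝ) (hF : Monotone F) (hG : Monotone G)
    (hF0 : ∀ a, 0 ≤ F a) (hG0 : ∀ a, 0 ≤ G a) :
    (∫ ω in {ω : BondConfig V | ∀ s ∈ S, ∀ x ∈ X, ¬ (openGraph ω).Reachable s x},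
        F (⋃ s ∈ S, openEdgeCluster ω s) ∂(prodBernoulli w)) *
      (∫ ω in {ω : BondConfig V | ∀ s ∈ S, ∀ x ∈ Y, ¬ (openGraph ω).Reachable s x},
        G (⋃ s ∈ S, openEdgeCluster ω s) ∂(prodBernoulli w)) ≤
    (∫ ω in {ω : BondConfig V | ∀ s ∈ S, ∀ x ∈ X ∩ Y, ¬ (openGraph ω).Reachable s x},
        F (⋃ s ∈ S, openEdgeCluster ω s) * G (⋃ s ∈ S, openEdgeCluster ω s) ∂(prodBernoulli w)) *
      (prodBernoulli w).real
        {ω : BondConfig V | ∀ s ∈ S, ∀ x ∈ X ∪ Y, ¬ (openGraph ω).Reachable s x} := by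
  classical
  have key := BHK2006_twoSeparationSets_fun (hubWeight w (sides S (∅ : Set V))) (Sum.inr true)
    (Sum.inl '' X) (Sum.inl '' Y)
    (fun C => F (restrictConfig Sum.inl C)) (fun C => G (restrictConfig Sum.inl C))
    (fun _ _ h => hF (restrictConfig_mono' Sum.inl h))
    (fun _ _ h => hG (restrictConfig_mono' Sum.inl h)) (fun _ => hF0 _) (fun _ => hG0 _)
  rw [← image_inter Sum.inl_injective, ← image_union] at key
  simp only [setIntegral_hub, measureReal_hub, hubConfig_preimage_forall_not_reachable,
    restrictConfig_openEdgeCluster_hub_empty] at key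
  exact key

open TripodExchange TwoSeparationSets TwoSetConditionalAssociation in
/-- **Theorem 1.1 with the source a SET of vertices** (events; BHK Remark 1 after Thm. 1.2, p. 5).
For increasing events `A = {ω | P (C_S ω)}`, `B = {ω | Q (C_S ω)}` determined by
`C_S = ⋃_{s ∈ S} C_s` and `R_W = {S ↮ W}`:
`μ(R_X ∩ A) · μ(R_Y ∩ B) ≤ μ(R_{X∩Y} ∩ (A ∩ B)) · μ(R_{X∪Y})`.  E.g. `A = {S ↔ every vertex of W₁}`,
`B = {S ↔ some vertex of W₂}` are admissible (`{S ↔ a} = {a ∈ S ∨ ∃ e ∈ C_S, a ∈ e}`,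
`TwoSetConditionalAssociation.setOf_mem_or_exists_mem_biUnion_openEdgeCluster`).
[cite: VandenbergHaggstromKahn2005, Thm. 1.1 (p. 3) with Remark 1 after Thm. 1.2 (p. 5)] -/
theorem BHK2006_setTwoSeparationSets [Fintype V] (w : Sym2 V → unitInterval) (S X Y : Set V)
    (P Q : Set (Sym2 V) → Prop)
    (hP : ∀ ⦃C C' : Set (Sym2 V)⦄, C ⊆ C' → P C → P C')
    (hQ : ∀ ⦃C C' : Set (Sym2 V)⦄, C ⊆ C' → Q C → Q C') :
    (prodBernoulli w).real ({ω : BondConfig V | ∀ s ∈ S, ∀ x ∈ X, ¬ (openGraph ω).Reachable s x} ∩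
        {ω | P (⋃ s ∈ S, openEdgeCluster ω s)}) *
      (prodBernoulli w).real ({ω : BondConfig V | ∀ s ∈ S, ∀ x ∈ Y, ¬ (openGraph ω).Reachable s x} ∩
        {ω | Q (⋃ s ∈ S, openEdgeCluster ω s)}) ≤
    (prodBernoulli w).real
        ({ω : BondConfig V | ∀ s ∈ S, ∀ x ∈ X ∩ Y, ¬ (openGraph ω).Reachable s x} ∩
          ({ω | P (⋃ s ∈ S, openEdgeCluster ω s)} ∩ {ω | Q (⋃ s ∈ S, openEdgeCluster ω s)})) *
      (prodBernoulli w).real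
        {ω : BondConfig V | ∀ s ∈ S, ∀ x ∈ X ∪ Y, ¬ (openGraph ω).Reachable s x} := by
  classical
  have key := BHK2006_setTwoSeparationSets_fun w S X Y
    (fun C => if P C then (1 : ℝ) else 0) (fun C => if Q C then (1 : ℝ) else 0)
    (predIndicator_monotone hP) (predIndicator_monotone hQ)
    (fun a => by split_ifs <;> norm_num) (fun a => by split_ifs <;> norm_num)
  simp only [predIndicator_eq_indicator (fun ω => P (⋃ s ∈ S, openEdgeCluster ω s)),
    predIndicator_eq_indicator (fun ω => Q (⋃ s ∈ S, openEdgeCluster ω s)),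
    setIntegral_indicator_one_eq, setIntegral_indicator_mul_indicator_eq] at key
  exact key

/-- **Set-source separation events are log-supermodular**: `μ{S ↮ X} · μ{S ↮ Y} ≤
μ{S ↮ X∩Y} · μ{S ↮ X∪Y}` (Remark (ii) p. 16 with Remark 1 p. 5).
[cite: VandenbergHaggstromKahn2005, Remark (ii) after Thm. 3.2 (p. 16), Thm. 1.1 (p. 3), Remark 1 after Thm. 1.2 (p. 5)] -/
theorem BHK2006_setTwoSeparationSets.separationEvents [Fintype V] (w : Sym2 V → unitInterval)
    (S X Y : Set V) :
    (prodBernoulli w).real {ω : BondConfig V | ∀ s ∈ S, ∀ x ∈ X, ¬ (openGraph ω).Reachable s x} *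
      (prodBernoulli w).real {ω : BondConfig V | ∀ s ∈ S, ∀ x ∈ Y, ¬ (openGraph ω).Reachable s x} ≤
    (prodBernoulli w).real
        {ω : BondConfig V | ∀ s ∈ S, ∀ x ∈ X ∩ Y, ¬ (openGraph ω).Reachable s x} *
      (prodBernoulli w).real
        {ω : BondConfig V | ∀ s ∈ S, ∀ x ∈ X ∪ Y, ¬ (openGraph ω).Reachable s x} := by
  have key := BHK2006_setTwoSeparationSets w S X Y (fun _ => True) (fun _ => True)
    (fun _ _ _ h => h) (fun _ _ _ h => h)
  simpa only [setOf_true, inter_univ] using key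

/-! ## van den Berg–Kahn (2001), Theorem 1.2: connection events against separation events

The case of Theorem 1.1 in which `A = Q_{W₁} = {s ↔ w ∀ w ∈ W₁}` and `B = Q_{W₂}` (BHK, Remark after
Thm. 1.1, p. 3: "Theorem 1.2 in [BK01] is the special case where each of `A`, `B` is of the form
`{s ↔ w ∀ w ∈ W}` for some `W ⊂ V`"), as printed in van den Berg–Kahn, Ann. Probab. 29 (2001),
p. 123: "From now on we fix `s ∈ V`, and set, for `X ⊆ V`, `Q_X = {s ↔ x ∀ x ∈ X}` and
`R_X = {s ↮ x ∀ x ∈ X}`.  **Theorem 1.2.** For any `A, B, X, Y ⊆ V`,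
`P(Q_A R_X) P(Q_B R_Y) ≤ P(Q_{A∪B} R_{X∩Y}) P(R_{X∪Y})`.  (1)"; and p. 124, Remark 3: "Theorem 1.1
can be generalized to sets of vertices `S, A, B, T` by replacing `s` by `S`, …, `t` by `T`, and
interpreting `X ↔ Y` as `{∃ x ∈ X, y ∈ Y, x ↔ y}`. To see this, simply identify all vertices in each
of `S, A, B, T`".  (Remark 2 there records what FAILS: "the perhaps intuitively more natural statement
obtained by replacing `R_{X∪Y}` by `Q_{A∩B} R_{X∪Y}` in Theorem 1.2 is not true: take
`V(G) = {s, x, y, a}`, `E(G) = {sx, xa, ay, ys}` and `X = {x}`, `Y = {y}`, `A = B = {a}`".) -/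

namespace TwoSeparationSets

/-- `Q_W = {s ↔ w ∀ w ∈ W}` read off the open edge cluster of `s`. [cite: VandenbergKahn2001, §1 p. 123 (definition of Q_X)] -/
theorem setOf_forall_reachable_eq (s : V) (W : Set V) :
    {ω : BondConfig V | ∀ a ∈ W, a = s ∨ ∃ e ∈ openEdgeCluster ω s, a ∈ e} =
      {ω : BondConfig V | ∀ a ∈ W, (openGraph ω).Reachable s a} := by
  ext ω
  simp only [mem_setOf_eq, reachable_iff_exists_mem_openEdgeCluster]

/-- `{S ↔ w ∀ w ∈ W}` (`S ↔ w = ∃ s ∈ S, s ↔ w`, vdBK Remark 3) read off `C_S = ⋃_{s ∈ S} C_s`.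
[cite: VandenbergKahn2001, p. 124 Remark 3] -/
theorem setOf_forall_exists_reachable_eq (S W : Set V) :
    {ω : BondConfig V | ∀ a ∈ W, a ∈ S ∨ ∃ e ∈ ⋃ s ∈ S, openEdgeCluster ω s, a ∈ e} =
      {ω : BondConfig V | ∀ a ∈ W, ∃ s ∈ S, (openGraph ω).Reachable s a} := by
  ext ω
  simp only [mem_setOf_eq]
  refine forall₂_congr fun a _ => ?_
  constructor
  · rintro (ha | ⟨e, he, hae⟩)
    · exact ⟨a, ha, SimpleGraph.Reachable.refl a⟩
    · obtain ⟨s, hs, he'⟩ := mem_iUnion₂.1 he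
      exact ⟨s, hs, ((mem_openEdgeCluster_iff ω s e).1 he').2.2 a hae⟩
  · rintro ⟨s, hs, hsa⟩
    rcases (reachable_iff_exists_mem_openEdgeCluster ω s a).1 hsa with rfl | ⟨e, he, hae⟩
    · exact Or.inl hs
    · exact Or.inr ⟨e, mem_iUnion₂.2 ⟨s, hs, he⟩, hae⟩

end TwoSeparationSets

open TwoSeparationSets in
/-- **van den Berg–Kahn (2001), Theorem 1.2.**  "For any `A, B, X, Y ⊆ V`,
`P(Q_A R_X) P(Q_B R_Y) ≤ P(Q_{A∪B} R_{X∩Y}) P(R_{X∪Y})`" with `Q_W = {s ↔ w ∀ w ∈ W}`,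
`R_W = {s ↮ w ∀ w ∈ W}` (bond percolation with arbitrary edge probabilities; here on a finite vertex
type, `μ = prodBernoulli w`):
`μ(R_X ∩ Q_A) · μ(R_Y ∩ Q_B) ≤ μ(R_{X∩Y} ∩ Q_{A∪B}) · μ(R_{X∪Y})` — the case of BHK's Theorem 1.1
(`BHK2006_twoSeparationSets`) with the increasing cluster events `Q_A`, `Q_B` (`Q_A ∩ Q_B = Q_{A∪B}`).
[cite: VandenbergKahn2001, Thm. 1.2 (p. 123, eq. (1))] -/
theorem VandenbergKahn2001_connectionSeparation [Fintype V] (w : Sym2 V → unitInterval) (s : V)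
    (A B X Y : Set V) :
    (prodBernoulli w).real ({ω : BondConfig V | ∀ x ∈ X, ¬ (openGraph ω).Reachable s x} ∩
        {ω | ∀ a ∈ A, (openGraph ω).Reachable s a}) *
      (prodBernoulli w).real ({ω : BondConfig V | ∀ x ∈ Y, ¬ (openGraph ω).Reachable s x} ∩
        {ω | ∀ a ∈ B, (openGraph ω).Reachable s a}) ≤
    (prodBernoulli w).real ({ω : BondConfig V | ∀ x ∈ X ∩ Y, ¬ (openGraph ω).Reachable s x} ∩
        {ω | ∀ a ∈ A ∪ B, (openGraph ω).Reachable s a}) *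
      (prodBernoulli w).real {ω : BondConfig V | ∀ x ∈ X ∪ Y, ¬ (openGraph ω).Reachable s x} := by
  have key := BHK2006_twoSeparationSets w s X Y
    (fun C => ∀ a ∈ A, a = s ∨ ∃ e ∈ C, a ∈ e) (fun C => ∀ a ∈ B, a = s ∨ ∃ e ∈ C, a ∈ e)
    (fun C C' hCC' h a ha => (h a ha).imp_right fun ⟨e, he, hae⟩ => ⟨e, hCC' he, hae⟩)
    (fun C C' hCC' h a ha => (h a ha).imp_right fun ⟨e, he, hae⟩ => ⟨e, hCC' he, hae⟩)
  have hAB : ({ω : BondConfig V | ∀ a ∈ A, a = s ∨ ∃ e ∈ openEdgeCluster ω s, a ∈ e} ∩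
      {ω : BondConfig V | ∀ a ∈ B, a = s ∨ ∃ e ∈ openEdgeCluster ω s, a ∈ e}) =
      {ω : BondConfig V | ∀ a ∈ A ∪ B, (openGraph ω).Reachable s a} := by
    rw [setOf_forall_reachable_eq, setOf_forall_reachable_eq]
    ext ω
    simp only [mem_inter_iff, mem_setOf_eq, mem_union, or_imp, forall_and]
  rw [hAB, setOf_forall_reachable_eq, setOf_forall_reachable_eq] at key
  exact key

open TwoSeparationSets in
/-- **van den Berg–Kahn (2001), Theorem 1.2 with the source a set `S`** (their Remark 3, p. 124:
"replacing `s` by `S` … and interpreting `X ↔ Y` as `{∃ x ∈ X, y ∈ Y, x ↔ y}`"):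
`μ({S ↮ X} ∩ {S ↔ a ∀ a ∈ A}) · μ({S ↮ Y} ∩ {S ↔ b ∀ b ∈ B}) ≤ μ({S ↮ X∩Y} ∩ {S ↔ c ∀ c ∈ A∪B}) · μ({S ↮ X∪Y})`
with `{S ↔ a} = {∃ s ∈ S, s ↔ a}`, `{S ↮ W} = {∀ s ∈ S, ∀ x ∈ W, s ↮ x}`.  From
`BHK2006_setTwoSeparationSets`.
[cite: VandenbergKahn2001, Thm. 1.2 (p. 123) with Remark 3 (p. 124)] -/
theorem VandenbergKahn2001_setConnectionSeparation [Fintype V] (w : Sym2 V → unitInterval)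
    (S A B X Y : Set V) :
    (prodBernoulli w).real ({ω : BondConfig V | ∀ s ∈ S, ∀ x ∈ X, ¬ (openGraph ω).Reachable s x} ∩
        {ω | ∀ a ∈ A, ∃ s ∈ S, (openGraph ω).Reachable s a}) *
      (prodBernoulli w).real ({ω : BondConfig V | ∀ s ∈ S, ∀ x ∈ Y, ¬ (openGraph ω).Reachable s x} ∩
        {ω | ∀ a ∈ B, ∃ s ∈ S, (openGraph ω).Reachable s a}) ≤
    (prodBernoulli w).real
        ({ω : BondConfig V | ∀ s ∈ S, ∀ x ∈ X ∩ Y, ¬ (openGraph ω).Reachable s x} ∩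
          {ω | ∀ a ∈ A ∪ B, ∃ s ∈ S, (openGraph ω).Reachable s a}) *
      (prodBernoulli w).real
        {ω : BondConfig V | ∀ s ∈ S, ∀ x ∈ X ∪ Y, ¬ (openGraph ω).Reachable s x} := by
  have key := BHK2006_setTwoSeparationSets w S X Y
    (fun C => ∀ a ∈ A, a ∈ S ∨ ∃ e ∈ C, a ∈ e) (fun C => ∀ a ∈ B, a ∈ S ∨ ∃ e ∈ C, a ∈ e)
    (fun C C' hCC' h a ha => (h a ha).imp_right fun ⟨e, he, hae⟩ => ⟨e, hCC' he, hae⟩)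
    (fun C C' hCC' h a ha => (h a ha).imp_right fun ⟨e, he, hae⟩ => ⟨e, hCC' he, hae⟩)
  have hAB : ({ω : BondConfig V | ∀ a ∈ A, a ∈ S ∨ ∃ e ∈ ⋃ s ∈ S, openEdgeCluster ω s, a ∈ e} ∩
      {ω : BondConfig V | ∀ a ∈ B, a ∈ S ∨ ∃ e ∈ ⋃ s ∈ S, openEdgeCluster ω s, a ∈ e}) =
      {ω : BondConfig V | ∀ a ∈ A ∪ B, ∃ s ∈ S, (openGraph ω).Reachable s a} := by
    rw [setOf_forall_exists_reachable_eq, setOf_forall_exists_reachable_eq]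
    ext ω
    simp only [mem_inter_iff, mem_setOf_eq, mem_union, or_imp, forall_and]
  rw [hAB, setOf_forall_exists_reachable_eq, setOf_forall_exists_reachable_eq] at key
  exact key

end Literature.Probability.Percolation

end
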